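/-
Copyright (c) 2026 the pub-hodgecm-mathlib formalisation cell (harness21).  Prover seat hodgecm-mathlib-F0P2-p01 (g15): road «S3-ram» (LEAD F0P3a-plan (g12); architect
A-p16 (g31) 23:19:27Z deal G2; owner F0P3a-p06 (g15)), organ A′ (ii) «the rank of the drop-1 child» — the LEV₂ READING asked by F0P3a-p01 (g16) 23:31:55Z; 2026-09-01.
-/
import Literature.NumberTheory.Automorphic.UnitaryLatticeTreeFixedChildRankRamified   -- ★∕filed (this seat): FILE G — pivots `v_childFrame_conj_{one_zero,two_one}_eq_iff`, `v_childFrame_conj_le_of_corner`, `…_apply_le_of_le`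
import HarnessLib

/-!
# The lattice graph of a hermitian space — THE RANK OF THE DROP-1 CHILD, LATTICE READING: `(γ−1)²Λ′ ⊆ ϖ^{2d−1}Λ′` iff NOT both pivots are units
# (Bruhat–Tits 1972 §10; Tits 1979 §3.5; Kottwitz 1986 §3)

Topic `NumberTheory/Automorphic`; namespace `Literature.NumberTheory.Automorphic.UnitaryLatticeTree`.  THEOREMS ONLY (no definition, no instance, no notation, no named fact,
no `sorry`); kernel lane `--supports stmt-HodgeConjecture-24833`.  Cell `pub/hodgecm-mathlib` (D-0151), crux H413; road «S3-ram» (Literature seeding, count-neutral), organ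
A′ (ii), gap G2 of the (a2)(B) blueprint (F0P3a-p01 (g16)) — rider to FILE G.  The tree induction G5 is VALUATION-LEVEL: its rank token for a fixed self-dual vertex `Λ`
of depth `e` is «rank `≤ 1` ⟺ `(γ−1)²Λ ⊆ ϖ^{2e+1}Λ`» (LEV₂; for the nilpotent `3 × 3` residual matrix `Ȳ`, rank `2 ⟺ Ȳ² ≠ 0`), which for the child `Λ′ = latt(κ·g)`
(`g = g(a,b)` the child frame, `M = κ⁻¹(γ−1)κ`, `M′ = g⁻¹Mg`, so `(κg)⁻¹(γ−1)²(κg) = M′²`) of depth `e = d − 1` reads «every entry of `M′²` is `≤ |ϖ|^{2d−1}`» (★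
`map_sub_one_latt_le_scaleLattice_iff` ∕ `mapGL_eq_and_level_iff_map_levelShift_le`).  THIS FILE computes `M′²` to that order.  DATUM-FREE (`K` with `Valued K ℤᵐ⁰`; no `σ`).

THE MATHEMATICS.  Under FILE G's drop-1 hypotheses (`|M_{ij}| ≤ |ϖ|^d`, `d ≥ 1`, corner passes `|M₂₀| ≤ |ϖ|^{d+1}`, `|a| = 1`, `|b| ≤ 1`) every entry of `M′` is `≤ |ϖ|^{d−1}`
and the six with `i ≤ j` are `≤ |ϖ|^d` (FILE G §1); a product `M′_{ik}M′_{kj}` is of top size `|ϖ|^{2d−2}` only if `i > k > j`, i.e. `(i,k,j) = (2,1,0)`.  Hence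
`|(M′²)_{ij}| ≤ |ϖ|^{2d−1}` for `(i,j) ≠ (2,0)` (`v_childFrame_conj_sq_apply_le`), `|(M′²)₂₀ − M′₂₁M′₁₀| ≤ |ϖ|^{2d−1}` (`v_childFrame_conj_sq_two_zero_sub_le`),
`|M′₂₁M′₁₀| = |ϖ|^{2d−2} ↔ (|M₁₀| = |ϖ|^d ∧ |M₂₁| = |ϖ|^d)` (`v_childFrame_conj_two_one_mul_one_zero_eq_iff`, the two pivots of FILE G), and THE TOKEN
**`(∀ i j, |(M′²)_{ij}| ≤ |ϖ|^{2d−1}) ↔ ¬(|M₁₀| = |ϖ|^d ∧ |M₂₁| = |ϖ|^d)`** (`forall_v_childFrame_conj_sq_le_iff`): the drop-1 child has rank `≤ 1` iff NOT both pivots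
are units — and by FILE G §2 (`v_coe_sub_one_one_zero_eq_iff`, unitarity) the two pivots agree, so rank `2 ⟺ |M₁₀| = |B₀(κe₁,(γ−1)κe₀)| = |ϖ|^d ⟺ x̄ ∉ ker Ȳ`.

* `v_mul_self_apply_le_of_upper_le`, `v_mul_self_two_zero_sub_le_of_upper_le` (generic), `v_childFrame_conj_sq_apply_le`, `v_childFrame_conj_sq_two_zero_sub_le`, `v_childFrame_conj_two_one_mul_one_zero_eq_iff`, **`forall_v_childFrame_conj_sq_le_iff`**.

HONEST LABEL: HC_CM is proved only modulo the 2 remaining named inputs (hLiu418 24832, h413 24833) until rung 0 closes; nothing printed is asserted here (elementary algebra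
over a valuation ring); «S3-ram» has no books consequence.

## References
* [BruhatTits1972] F. Bruhat, J. Tits, *Groupes réductifs sur un corps local I*, Publ. Math. IHÉS 41 (1972), §10 (lattice models; vertex stabilisers and their filtrations).
* [Tits1979] J. Tits, *Reductive groups over local fields*, PSPM 33.1 (1979), §3.5 (congruence filtration; reduction mod `𝔭`).
* [Kottwitz1986] R. E. Kottwitz, *Base change for unit elements of Hecke algebras*, Compositio Math. 60 (1986), §3 (levels of fixed lattices; shell recursion).
* [Serre1980Trees] J.-P. Serre, *Trees* (1980), Ch. II §1.1–1.2 (lattices and frames).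
-/

set_option autoImplicit false

noncomputable section

open scoped Valued WithZero Matrix MatrixGroups

namespace Literature.NumberTheory.Automorphic.UnitaryLatticeTree

open Literature.NumberTheory.Automorphic Literature.NumberTheory.Automorphic.HermitianLattice

variable {K : Type*} [Field K] [Valued K ℤᵐ⁰] {ϖ : K}

/-- **Squares of residually strictly-lower matrices, off the corner**: if every entry of `P` is `≤ s₁` and the six entries `P_{kl}`, `k ≤ l`, are `≤ s₀`, then
`|(P²)_{ij}| ≤ s₀·s₁` for `(i,j) ≠ (2,0)` — a product `P_{ik}P_{kj}` avoids the small entries only if `i > k > j`. [cite: Kottwitz1986, §3] [cite: Tits1979, §3.5] -/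
theorem v_mul_self_apply_le_of_upper_le {P : Matrix (Fin 3) (Fin 3) K} {s₀ s₁ : ℤᵐ⁰} (hbig : ∀ k l, Valued.v (P k l) ≤ s₁)
    (hsmall : ∀ k l : Fin 3, k ≤ l → Valued.v (P k l) ≤ s₀) {i j : Fin 3} (hij : ¬ (i = 2 ∧ j = 0)) :
    Valued.v ((P * P) i j) ≤ s₀ * s₁ := by
  have hterm : ∀ k : Fin 3, Valued.v (P i k * P k j) ≤ s₀ * s₁ := by
    intro k
    by_cases hik : i ≤ k
    · rw [map_mul]; exact mul_le_mul' (hsmall i k hik) (hbig k j)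
    by_cases hkj : k ≤ j
    · rw [map_mul, mul_comm s₀]; exact mul_le_mul' (hbig i k) (hsmall k j hkj)
    exfalso
    revert hik hkj hij
    fin_cases i <;> fin_cases j <;> fin_cases k <;> decide
  rw [Matrix.mul_apply]
  exact Valuation.map_sum_le _ fun k _ => hterm k

/-- **… and at the corner `(P²)₂₀ ≡ P₂₁P₁₀`**: `|(P²)₂₀ − P₂₁P₁₀| ≤ s₀·s₁` under the same bounds. [cite: Kottwitz1986, §3] [cite: Tits1979, §3.5] -/
theorem v_mul_self_two_zero_sub_le_of_upper_le {P : Matrix (Fin 3) (Fin 3) K} {s₀ s₁ : ℤᵐ⁰} (hbig : ∀ k l, Valued.v (P k l) ≤ s₁)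
    (hsmall : ∀ k l : Fin 3, k ≤ l → Valued.v (P k l) ≤ s₀) :
    Valued.v ((P * P) 2 0 - P 2 1 * P 1 0) ≤ s₀ * s₁ := by
  have e : (P * P) 2 0 - P 2 1 * P 1 0 = P 2 0 * P 0 0 + P 2 2 * P 2 0 := by
    rw [Matrix.mul_apply, Fin.sum_univ_three]; ring
  rw [e]
  refine (Valuation.map_add _ _ _).trans (max_le ?_ ?_)
  · rw [map_mul, mul_comm s₀]; exact mul_le_mul' (hbig 2 0) (hsmall 0 0 (by decide))
  · rw [map_mul]; exact mul_le_mul' (hsmall 2 2 (by decide)) (hbig 2 0)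

/-- **Off the corner, `M′²` vanishes at order `2d − 2`**: `|(M′²)_{ij}| ≤ |ϖ|^{2d−1}` for `(i,j) ≠ (2,0)` (drop-1 hypotheses of FILE G: `|M_{ij}| ≤ |ϖ|^d`, `d ≥ 1`,
`|M₂₀| ≤ |ϖ|^{d+1}`, `|a| = 1`, `|b| ≤ 1`). [cite: Kottwitz1986, §3] [cite: Tits1979, §3.5] -/
theorem v_childFrame_conj_sq_apply_le (hϖ : Valued.v ϖ = WithZero.exp (-1 : ℤ)) {a b : K} (ha : Valued.v a = 1) (hb : Valued.v b ≤ 1)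
    {d : ℕ} (hd : 1 ≤ d) {M : Matrix (Fin 3) (Fin 3) K} (hM : ∀ i j, Valued.v (M i j) ≤ Valued.v ϖ ^ d) (h20 : Valued.v (M 2 0) ≤ Valued.v ϖ ^ (d + 1))
    {i j : Fin 3} (hij : ¬ (i = 2 ∧ j = 0)) :
    Valued.v ((((!![ϖ / a, 0, 0; 0, 1, 0; -b / a, 0, ϖ⁻¹] : Matrix (Fin 3) (Fin 3) K) * M * !![a / ϖ, 0, 0; 0, 1, 0; b, 0, ϖ]) *
      ((!![ϖ / a, 0, 0; 0, 1, 0; -b / a, 0, ϖ⁻¹] : Matrix (Fin 3) (Fin 3) K) * M * !![a / ϖ, 0, 0; 0, 1, 0; b, 0, ϖ])) i j) ≤ Valued.v ϖ ^ (2 * d - 1) := by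
  have hsum : Valued.v ϖ ^ (2 * d - 1) = Valued.v ϖ ^ d * Valued.v ϖ ^ (d - 1) := by rw [← pow_add]; congr 1; omega
  rw [hsum]
  exact v_mul_self_apply_le_of_upper_le (fun k l => v_childFrame_conj_le_of_corner hϖ ha hb hd hM h20 k l)
    (fun k l hkl => v_childFrame_conj_apply_le_of_le hϖ ha hb hM hkl) hij

/-- **At the corner, `(M′²)₂₀ ≡ M′₂₁·M′₁₀`** to order `2d − 2`: `|(M′²)₂₀ − M′₂₁M′₁₀| ≤ |ϖ|^{2d−1}`. [cite: Kottwitz1986, §3] [cite: Tits1979, §3.5] -/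
theorem v_childFrame_conj_sq_two_zero_sub_le (hϖ : Valued.v ϖ = WithZero.exp (-1 : ℤ)) {a b : K} (ha : Valued.v a = 1) (hb : Valued.v b ≤ 1)
    {d : ℕ} (hd : 1 ≤ d) {M : Matrix (Fin 3) (Fin 3) K} (hM : ∀ i j, Valued.v (M i j) ≤ Valued.v ϖ ^ d) (h20 : Valued.v (M 2 0) ≤ Valued.v ϖ ^ (d + 1)) :
    Valued.v ((((!![ϖ / a, 0, 0; 0, 1, 0; -b / a, 0, ϖ⁻¹] : Matrix (Fin 3) (Fin 3) K) * M * !![a / ϖ, 0, 0; 0, 1, 0; b, 0, ϖ]) *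
        ((!![ϖ / a, 0, 0; 0, 1, 0; -b / a, 0, ϖ⁻¹] : Matrix (Fin 3) (Fin 3) K) * M * !![a / ϖ, 0, 0; 0, 1, 0; b, 0, ϖ])) 2 0 -
      ((!![ϖ / a, 0, 0; 0, 1, 0; -b / a, 0, ϖ⁻¹] : Matrix (Fin 3) (Fin 3) K) * M * !![a / ϖ, 0, 0; 0, 1, 0; b, 0, ϖ]) 2 1 *
      ((!![ϖ / a, 0, 0; 0, 1, 0; -b / a, 0, ϖ⁻¹] : Matrix (Fin 3) (Fin 3) K) * M * !![a / ϖ, 0, 0; 0, 1, 0; b, 0, ϖ]) 1 0) ≤ Valued.v ϖ ^ (2 * d - 1) := by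
  have hsum : Valued.v ϖ ^ (2 * d - 1) = Valued.v ϖ ^ d * Valued.v ϖ ^ (d - 1) := by rw [← pow_add]; congr 1; omega
  rw [hsum]
  exact v_mul_self_two_zero_sub_le_of_upper_le (fun k l => v_childFrame_conj_le_of_corner hϖ ha hb hd hM h20 k l)
    (fun k l hkl => v_childFrame_conj_apply_le_of_le hϖ ha hb hM hkl)

/-- **Both pivots at once**: `|M′₂₁·M′₁₀| = |ϖ|^{2d−2} ↔ (|M₁₀| = |ϖ|^d ∧ |M₂₁| = |ϖ|^d)` (each factor is `≤ |ϖ|^{d−1}`, FILE G's pivots translate).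
[cite: Kottwitz1986, §3] [cite: Tits1979, §3.5] -/
theorem v_childFrame_conj_two_one_mul_one_zero_eq_iff (hϖ : Valued.v ϖ = WithZero.exp (-1 : ℤ)) {a b : K} (ha : Valued.v a = 1) (hb : Valued.v b ≤ 1)
    {d : ℕ} (hd : 1 ≤ d) {M : Matrix (Fin 3) (Fin 3) K} (hM : ∀ i j, Valued.v (M i j) ≤ Valued.v ϖ ^ d) (h20 : Valued.v (M 2 0) ≤ Valued.v ϖ ^ (d + 1)) :
    Valued.v ((((!![ϖ / a, 0, 0; 0, 1, 0; -b / a, 0, ϖ⁻¹] : Matrix (Fin 3) (Fin 3) K) * M * !![a / ϖ, 0, 0; 0, 1, 0; b, 0, ϖ]) 2 1) *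
      ((!![ϖ / a, 0, 0; 0, 1, 0; -b / a, 0, ϖ⁻¹] : Matrix (Fin 3) (Fin 3) K) * M * !![a / ϖ, 0, 0; 0, 1, 0; b, 0, ϖ]) 1 0) = Valued.v ϖ ^ (2 * d - 2) ↔
      (Valued.v (M 1 0) = Valued.v ϖ ^ d ∧ Valued.v (M 2 1) = Valued.v ϖ ^ d) := by
  set P : Matrix (Fin 3) (Fin 3) K := ((!![ϖ / a, 0, 0; 0, 1, 0; -b / a, 0, ϖ⁻¹] : Matrix (Fin 3) (Fin 3) K) * M * !![a / ϖ, 0, 0; 0, 1, 0; b, 0, ϖ]) with hP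
  have hϖ0 : ϖ ≠ 0 := fun h0 => by rw [h0, map_zero] at hϖ; exact WithZero.coe_ne_zero hϖ.symm
  have hvϖ0 : Valued.v ϖ ≠ 0 := (Valuation.ne_zero_iff _).2 hϖ0
  have hs0 : Valued.v ϖ ^ (d - 1) ≠ 0 := pow_ne_zero _ hvϖ0
  have hsq : Valued.v ϖ ^ (2 * d - 2) = Valued.v ϖ ^ (d - 1) * Valued.v ϖ ^ (d - 1) := by rw [← pow_add]; congr 1; omega
  have h21le : Valued.v (P 2 1) ≤ Valued.v ϖ ^ (d - 1) := v_childFrame_conj_le_of_corner hϖ ha hb hd hM h20 2 1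
  have h10le : Valued.v (P 1 0) ≤ Valued.v ϖ ^ (d - 1) := v_childFrame_conj_le_of_corner hϖ ha hb hd hM h20 1 0
  have hp10 := v_childFrame_conj_one_zero_eq_iff hϖ ha hb hd hM
  have hp21 := v_childFrame_conj_two_one_eq_iff hϖ ha hb hd hM
  rw [← hp10, ← hp21, map_mul, hsq]
  constructor
  · intro h
    -- if one factor were `< |ϖ|^(d-1)` the product would be `< |ϖ|^(2d-2)`
    have h21 : Valued.v (P 2 1) = Valued.v ϖ ^ (d - 1) := by
      refine le_antisymm h21le (not_lt.1 fun hlt => ?_)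
      have : Valued.v (P 2 1) * Valued.v (P 1 0) < Valued.v ϖ ^ (d - 1) * Valued.v ϖ ^ (d - 1) :=
        mul_lt_mul_of_lt_of_le_of_nonneg_of_pos hlt h10le zero_le (zero_lt_iff.2 hs0)
      exact this.ne h
    have h10 : Valued.v (P 1 0) = Valued.v ϖ ^ (d - 1) := by
      refine le_antisymm h10le (not_lt.1 fun hlt => ?_)
      have : Valued.v (P 2 1) * Valued.v (P 1 0) < Valued.v ϖ ^ (d - 1) * Valued.v ϖ ^ (d - 1) :=
        mul_lt_mul_of_le_of_lt_of_nonneg_of_pos h21le hlt zero_le (zero_lt_iff.2 hs0)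
      exact this.ne h
    exact ⟨h10, h21⟩
  · rintro ⟨h10, h21⟩
    rw [h10, h21]

/-- **THE LEV₂ TOKEN OF THE DROP-1 CHILD.**  Under the drop-1 hypotheses: **every entry of `M′²` is `≤ |ϖ|^{2d−1}` iff NOT both `|M₁₀| = |ϖ|^d` and `|M₂₁| = |ϖ|^d`** —
i.e. `(γ−1)²Λ′ ⊆ ϖ^{2(d−1)+1}Λ′` (the child has residual rank `≤ 1`) iff not both pivots are units; with unitarity (FILE G `v_coe_sub_one_one_zero_eq_iff`) the two
pivots agree, so the child has rank `2` iff `|M₁₀| = |B₀(κe₁, (γ−1)κe₀)| = |ϖ|^d`. [cite: Kottwitz1986, §3] [cite: Tits1979, §3.5] [cite: BruhatTits1972, §10] -/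
theorem forall_v_childFrame_conj_sq_le_iff (hϖ : Valued.v ϖ = WithZero.exp (-1 : ℤ)) {a b : K} (ha : Valued.v a = 1) (hb : Valued.v b ≤ 1)
    {d : ℕ} (hd : 1 ≤ d) {M : Matrix (Fin 3) (Fin 3) K} (hM : ∀ i j, Valued.v (M i j) ≤ Valued.v ϖ ^ d) (h20 : Valued.v (M 2 0) ≤ Valued.v ϖ ^ (d + 1)) :
    (∀ i j : Fin 3, Valued.v ((((!![ϖ / a, 0, 0; 0, 1, 0; -b / a, 0, ϖ⁻¹] : Matrix (Fin 3) (Fin 3) K) * M * !![a / ϖ, 0, 0; 0, 1, 0; b, 0, ϖ]) *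
      ((!![ϖ / a, 0, 0; 0, 1, 0; -b / a, 0, ϖ⁻¹] : Matrix (Fin 3) (Fin 3) K) * M * !![a / ϖ, 0, 0; 0, 1, 0; b, 0, ϖ])) i j) ≤ Valued.v ϖ ^ (2 * d - 1)) ↔
      ¬ (Valued.v (M 1 0) = Valued.v ϖ ^ d ∧ Valued.v (M 2 1) = Valued.v ϖ ^ d) := by
  set P : Matrix (Fin 3) (Fin 3) K := ((!![ϖ / a, 0, 0; 0, 1, 0; -b / a, 0, ϖ⁻¹] : Matrix (Fin 3) (Fin 3) K) * M * !![a / ϖ, 0, 0; 0, 1, 0; b, 0, ϖ]) with hP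
  have hϖ0 : ϖ ≠ 0 := fun h0 => by rw [h0, map_zero] at hϖ; exact WithZero.coe_ne_zero hϖ.symm
  have hvϖ0 : Valued.v ϖ ≠ 0 := (Valuation.ne_zero_iff _).2 hϖ0
  have hϖlt : Valued.v ϖ < 1 := by rw [hϖ, ← WithZero.exp_zero]; exact WithZero.exp_lt_exp.2 (by norm_num)
  have h2d : Valued.v ϖ ^ (2 * d - 1) = Valued.v ϖ * Valued.v ϖ ^ (2 * d - 2) := by rw [← pow_succ']; congr 1; omega
  have hlt : Valued.v ϖ ^ (2 * d - 1) < Valued.v ϖ ^ (2 * d - 2) := by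
    rw [h2d]; exact mul_lt_of_lt_one_left (zero_lt_iff.2 (pow_ne_zero _ hvϖ0)) hϖlt
  have hpiv := v_childFrame_conj_two_one_mul_one_zero_eq_iff hϖ ha hb hd hM h20
  have hcorner := v_childFrame_conj_sq_two_zero_sub_le hϖ ha hb hd hM h20
  constructor
  · intro hall hboth
    have hprod : Valued.v (P 2 1 * P 1 0) = Valued.v ϖ ^ (2 * d - 2) := hpiv.2 hboth
    -- `(P²)₂₀ = P₂₁P₁₀ + small` has exact size `|ϖ|^(2d-2) > |ϖ|^(2d-1)`
    have hlt' : Valued.v ((P * P) 2 0 - P 2 1 * P 1 0) < Valued.v (P 2 1 * P 1 0) := (hcorner.trans_lt hlt).trans_eq hprod.symm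
    have heq : Valued.v ((P * P) 2 0) = Valued.v ϖ ^ (2 * d - 2) := by rw [Valuation.map_eq_of_sub_lt _ hlt', hprod]
    exact (lt_irrefl _) (((hall 2 0).trans_lt hlt).trans_eq heq.symm)
  · intro hnot i j
    by_cases hij : i = 2 ∧ j = 0
    · obtain ⟨rfl, rfl⟩ := hij
      -- one pivot fails, so `|P₂₁P₁₀| ≤ |ϖ|^(2d-1)`
      have hsum : Valued.v ϖ ^ (2 * d - 1) = Valued.v ϖ ^ d * Valued.v ϖ ^ (d - 1) := by rw [← pow_add]; congr 1; omega
      have hdm : Valued.v ϖ ^ (d - 1) = Valued.v ϖ ^ d * WithZero.exp (1 : ℤ) := by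
        have : Valued.v ϖ ^ d = Valued.v ϖ ^ (d - 1) * Valued.v ϖ := by rw [← pow_succ]; congr 1; omega
        rw [this, hϖ, mul_assoc, ← WithZero.exp_add]; norm_num
      have h21le : Valued.v (P 2 1) ≤ Valued.v ϖ ^ (d - 1) := v_childFrame_conj_le_of_corner hϖ ha hb hd hM h20 2 1
      have h10le : Valued.v (P 1 0) ≤ Valued.v ϖ ^ (d - 1) := v_childFrame_conj_le_of_corner hϖ ha hb hd hM h20 1 0
      -- discreteness: `< |ϖ|^(d-1)` means `≤ |ϖ|^d`
      have hstep : ∀ {x : K}, Valued.v x < Valued.v ϖ ^ (d - 1) → Valued.v x ≤ Valued.v ϖ ^ d := fun {x} hx => by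
        rw [hdm] at hx; exact (WithZero.lt_mul_exp_iff_le (pow_ne_zero _ hvϖ0)).1 hx
      have hprod : Valued.v (P 2 1 * P 1 0) ≤ Valued.v ϖ ^ (2 * d - 1) := by
        rw [map_mul, hsum]
        by_cases h10 : Valued.v (M 1 0) = Valued.v ϖ ^ d
        · have h21 : Valued.v (P 2 1) < Valued.v ϖ ^ (d - 1) :=
            lt_of_le_of_ne h21le fun h => hnot ⟨h10, (v_childFrame_conj_two_one_eq_iff hϖ ha hb hd hM).1 h⟩
          exact mul_le_mul' (hstep h21) h10le
        · have h10' : Valued.v (P 1 0) < Valued.v ϖ ^ (d - 1) :=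
            lt_of_le_of_ne h10le fun h => h10 ((v_childFrame_conj_one_zero_eq_iff hϖ ha hb hd hM).1 h)
          rw [mul_comm (Valued.v ϖ ^ d)]
          exact mul_le_mul' h21le (hstep h10')
      have e : (P * P) 2 0 = ((P * P) 2 0 - P 2 1 * P 1 0) + P 2 1 * P 1 0 := by ring
      rw [e]
      exact (Valuation.map_add _ _ _).trans (max_le hcorner hprod)
    · exact v_childFrame_conj_sq_apply_le hϖ ha hb hd hM h20 hij

end Literature.NumberTheory.Automorphic.UnitaryLatticeTree

end
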